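import Literature.AlgebraicGeometry.Resolution.ResolutionOfCurves
import Mathlib.AlgebraicGeometry.Morphisms.ClosedImmersion
import Mathlib.AlgebraicGeometry.Morphisms.Separated
import Mathlib.AlgebraicGeometry.Morphisms.Finite
import Mathlib.AlgebraicGeometry.Morphisms.UniversallyInjective
import Mathlib.AlgebraicGeometry.IdealSheaf.Subscheme
import HarnessLib

/-!
# `PAlteration.Assembly` (stmt-ResolutionOfSingularities-0553): reduced structures and sections

Route `ResolutionOfSingularities/pAlteration`, item `Assembly` (stmt-0553). Generic scheme
lemmas used by the Frobenius-pullback argument (helper file, `--supports` the item):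

* `isIso_of_comp_eq_id_of_injective` — a separated morphism `π : Z → V` from a REDUCED scheme
  which is injective on points and admits a section `s` (`s ≫ π = 𝟙`) is an isomorphism
  (`s` is a surjective closed immersion into a reduced scheme).
* the reduced closed subscheme `T_red = (vanishingIdeal ⊤).subscheme` (Mathlib's reduced induced
  structure on the closed subset `⊤`): morphisms from reduced schemes factor through it
  (`exists_lift_reduced`), it is integral when `T` is irreducible, and its inclusion is a
  surjective closed immersion.
* `reduced pullback`: for `h : X → T` finite, universally injective and surjective and
  `ρ : Y → T` with `Y` integral, the reduced fibre product `(X ×_T Y)_red` is integral and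
  finite, universally injective and surjective over `Y`.
-/

-- single-problem summit: the doubled namespace component `ResolutionOfSingularities` is forced
set_option linter.dupNamespace false

noncomputable section

open CategoryTheory CategoryTheory.Limits AlgebraicGeometry TopologicalSpace Topology

namespace Summit.ResolutionOfSingularities.ResolutionOfSingularities.Theorems

universe u

open Scheme.IdealSheafData

/-! ## A morphism with a section -/

/-- A separated morphism `π : Z ⟶ V` with `Z` reduced, injective on points, admitting a section
`s ≫ π = 𝟙 V`, is an isomorphism: `s` is a closed immersion (a section of a separated morphism),
surjective because `π (s (π z)) = π z` forces `s (π z) = z`, hence an isomorphism since `Z` is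
reduced; then `π = s⁻¹`. [folklore] -/
theorem isIso_of_comp_eq_id_of_injective {Z V : Scheme.{u}} (π : Z ⟶ V) [IsSeparated π]
    [IsReduced Z] (hinj : Function.Injective π.base) (s : V ⟶ Z) (hs : s ≫ π = 𝟙 V) :
    IsIso π := by
  haveI : IsClosedImmersion (s ≫ π) := by rw [hs]; infer_instance
  haveI : IsClosedImmersion s := IsClosedImmersion.of_comp s π
  haveI : Surjective s := ⟨fun z => ⟨π.base z, hinj (by
    show (s ≫ π).base (π.base z) = π.base z
    rw [hs]; rfl)⟩⟩
  haveI : IsIso s := isIso_of_isClosedImmersion_of_surjective s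
  have : π = inv s := by
    rw [← cancel_epi s, hs, IsIso.hom_inv_id]
  rw [this]
  infer_instance

/-! ## The reduced closed subscheme -/

section Reduced

variable {X T : Scheme.{u}}

/-- The nilradical of `T` is contained in the kernel of any morphism from a reduced scheme.
[folklore] -/
theorem vanishingIdeal_top_le_ker (f : X ⟶ T) [IsReduced X] :
    vanishingIdeal (⊤ : Closeds T) ≤ f.ker := by
  rw [vanishingIdeal_top, Scheme.Hom.ker, le_ofIdeals_iff]
  intro U s hs
  simp only [Scheme.nilradical, radical_ideal, ideal_bot, Pi.bot_apply] at hs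
  obtain ⟨n, hn⟩ := hs
  simp only [Ideal.mem_bot] at hn
  have h : IsNilpotent ((f.app U).hom s) := ⟨n, by rw [← map_pow, hn, map_zero]⟩
  exact h.eq_zero

/-- A morphism from a reduced scheme factors through the reduced closed subscheme
`T_red = (vanishingIdeal ⊤).subscheme` of the target. [folklore] -/
theorem exists_lift_reduced (f : X ⟶ T) [IsReduced X] :
    ∃ f' : X ⟶ (vanishingIdeal (⊤ : Closeds T)).subscheme,
      f' ≫ (vanishingIdeal (⊤ : Closeds T)).subschemeι = f :=
  ⟨f.toImage ≫ inclusion (vanishingIdeal_top_le_ker f), by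
    rw [Category.assoc, inclusion_subschemeι, Scheme.Hom.toImage_imageι]⟩

/-- The inclusion of the reduced closed subscheme is surjective. [folklore] -/
instance surjective_subschemeι_vanishingIdeal_top :
    Surjective (vanishingIdeal (⊤ : Closeds T)).subschemeι :=
  ⟨by
    rw [← Set.range_eq_univ, Literature.AlgebraicGeometry.Resolution.range_subschemeι_vanishingIdeal]
    rfl⟩

/-- The reduced closed subscheme is reduced. [folklore] -/
instance isReduced_subscheme_vanishingIdeal_top :
    IsReduced (vanishingIdeal (⊤ : Closeds T)).subscheme :=
  Literature.AlgebraicGeometry.Resolution.isReduced_subscheme_vanishingIdeal ⊤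

/-- The reduced closed subscheme of an irreducible scheme is integral. [folklore] -/
theorem isIntegral_subscheme_vanishingIdeal_top [IrreducibleSpace T] :
    IsIntegral (vanishingIdeal (⊤ : Closeds T)).subscheme :=
  Literature.AlgebraicGeometry.Resolution.isIntegral_subscheme_vanishingIdeal ⊤
    (by simpa using IrreducibleSpace.isIrreducible_univ T)

/-- The inclusion of the reduced closed subscheme is a homeomorphism. [folklore] -/
theorem isHomeomorph_subschemeι_vanishingIdeal_top :
    IsHomeomorph (vanishingIdeal (⊤ : Closeds T)).subschemeι.base :=
  isHomeomorph_iff_continuous_isClosedMap_bijective.mpr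
    ⟨(vanishingIdeal (⊤ : Closeds T)).subschemeι.continuous,
      (vanishingIdeal (⊤ : Closeds T)).subschemeι.isClosedMap,
      (vanishingIdeal (⊤ : Closeds T)).subschemeι.isClosedEmbedding.injective,
      (vanishingIdeal (⊤ : Closeds T)).subschemeι.surjective⟩

/-- Over an open `U ⊆ T` which is reduced, the inclusion of the reduced closed subscheme
restricts to an isomorphism. [folklore] -/
theorem isIso_subschemeι_vanishingIdeal_top_morphismRestrict (U : T.Opens)
    [IsReduced (U : Scheme.{u})] :
    IsIso ((vanishingIdeal (⊤ : Closeds T)).subschemeι ∣_ U) := by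
  haveI : Surjective ((vanishingIdeal (⊤ : Closeds T)).subschemeι ∣_ U) := by
    refine ⟨fun x => ?_⟩
    obtain ⟨y, hy⟩ := (vanishingIdeal (⊤ : Closeds T)).subschemeι.surjective x.1
    refine ⟨⟨y, show y ∈ (vanishingIdeal (⊤ : Closeds T)).subschemeι ⁻¹ᵁ U from ?_⟩, ?_⟩
    · show (vanishingIdeal (⊤ : Closeds T)).subschemeι.base y ∈ U
      rw [hy]; exact x.2
    · apply Subtype.ext
      simp only [morphismRestrict_base_coe, hy]
  exact isIso_of_isClosedImmersion_of_surjective _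

end Reduced

/-! ## The reduced fibre product of a finite radicial surjective morphism -/

section ReducedPullback

variable {X Y T : Scheme.{u}} (h : X ⟶ T) (ρ : Y ⟶ T)

/-- A finite, universally injective, surjective morphism is a homeomorphism. [folklore] -/
theorem isHomeomorph_of_isFinite_of_universallyInjective_of_surjective {X T : Scheme.{u}}
    (h : X ⟶ T) [IsFinite h] [UniversallyInjective h] [Surjective h] :
    IsHomeomorph h.base :=
  isHomeomorph_iff_continuous_isClosedMap_bijective.mpr
    ⟨h.continuous, h.isClosedMap, h.injective, h.surjective⟩

/-- Universal injectivity is stable under base change (instance form for `pullback.snd`).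
[folklore] -/
instance universallyInjective_pullback_snd [UniversallyInjective h] :
    UniversallyInjective (pullback.snd h ρ) :=
  MorphismProperty.pullback_snd (P := @UniversallyInjective) _ _ ‹_›

/-- For `h : X → T` finite, universally injective and surjective and `ρ : Y → T` with `Y`
irreducible, the fibre product `X ×_T Y` is irreducible (it is homeomorphic to `Y`). [folklore] -/
theorem irreducibleSpace_pullback_of_universallyInjective [IsFinite h] [UniversallyInjective h]
    [Surjective h] [IrreducibleSpace Y] : IrreducibleSpace ↑(pullback h ρ) :=
  (isHomeomorph_of_isFinite_of_universallyInjective_of_surjective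
    (pullback.snd h ρ)).homeomorph.irreducibleSpace_iff.mpr ‹_›

/-- For `h : X → T` finite, universally injective and surjective and `ρ : Y → T` with `Y`
integral, the reduced fibre product `(X ×_T Y)_red` is integral. [folklore] -/
theorem isIntegral_reduced_pullback [IsFinite h] [UniversallyInjective h] [Surjective h]
    [IsIntegral Y] :
    IsIntegral (vanishingIdeal (⊤ : Closeds ↑(pullback h ρ))).subscheme :=
  haveI := irreducibleSpace_pullback_of_universallyInjective h ρ
  isIntegral_subscheme_vanishingIdeal_top

/-- The reduced fibre product `(X ×_T Y)_red → Y` of a finite, universally injective, surjective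
`h : X → T` is again finite, universally injective and surjective. [folklore] -/
theorem isFinite_reduced_pullback_snd [IsFinite h] :
    IsFinite ((vanishingIdeal (⊤ : Closeds ↑(pullback h ρ))).subschemeι ≫ pullback.snd h ρ) :=
  inferInstance

/-- See `isFinite_reduced_pullback_snd`. [folklore] -/
theorem universallyInjective_reduced_pullback_snd [UniversallyInjective h] :
    UniversallyInjective
      ((vanishingIdeal (⊤ : Closeds ↑(pullback h ρ))).subschemeι ≫ pullback.snd h ρ) :=
  MorphismProperty.comp_mem @UniversallyInjective _ _ inferInstance inferInstance

/-- See `isFinite_reduced_pullback_snd`. [folklore] -/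
theorem surjective_reduced_pullback_snd [Surjective h] :
    Surjective ((vanishingIdeal (⊤ : Closeds ↑(pullback h ρ))).subschemeι ≫ pullback.snd h ρ) :=
  inferInstance

end ReducedPullback

end Summit.ResolutionOfSingularities.ResolutionOfSingularities.Theorems

end
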